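import Literature.Geometry.Lorentzian.KillingHorizonShadowAlong
import Literature.Geometry.Lorentzian.DocAxisymmetricSpacetime
import Literature.Geometry.Lorentzian.CausalityOpennessProofs
import Literature.Geometry.Manifold.ProperFunctionTube

/-!
# Stub `stub_docComplete_of_axial` (P4) of crux `HawkingExtensionIsKerr`, line `SketchIdeator2`

Data: a stationary asymptotically flat black hole `𝓑` with (complete, global) stationary Killing
field `T = 𝓑.killing`, a Killing field `K'` of the (open) domain of outer communications
`⟨⟨M_ext⟩⟩ = 𝓑.doc` commuting with `T` there, and constants `a`, `b ≠ 0` such that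
`Φ := a • T + b • K'` has, through every point of `⟨⟨M_ext⟩⟩`, a whole-line integral curve
staying in `⟨⟨M_ext⟩⟩`.  Conclusion: so does `K' = b⁻¹ • (Φ - a • T)`.

Proof.  On the open submanifold `D := ⟨⟨M_ext⟩⟩` (`StationaryAFBlackHole.docOpens`) the
restrictions `X := T|_D` (`docKilling`) and `Y := Φ|_D` (`docAxial … Φ`) are `C^∞` global vector
fields (`contMDiff_docKilling`; `Φ` is `C^∞` on the open set `⟨⟨M_ext⟩⟩` and `C^∞`-on-an-open-set
sections restrict to `C^∞` sections of the open submanifold,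
`Literature.Geometry.Manifold.contMDiff_tangentSection_of_contMDiffOn`), both complete (`X`:
`isCompleteVectorField_docKilling`, the `T`-invariance of `⟨⟨M_ext⟩⟩`; `Y`: the hypothesis, the
curves co-restricted to `D`, `isMIntegralCurve_codRestrict`), and `[X, Y] = 0` (naturality of the
Lie bracket under the open embedding `D → M`, Mathlib's `VectorField.mpullback_mlieBracket`, and
`[T, a T + b K'] = a [T, T] + b [T, K'] = 0` at the points of the open set `⟨⟨M_ext⟩⟩`, where both
fields are differentiable).  Linear combinations of commuting complete `C^∞` fields are complete
(the flows commute and compose, Lee 2012, Thms. 9.12, 9.42, 9.44; in the tree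
`isCompleteVectorField_linearCombination_of_mlieBracket_eq_zero`), so
`(-(a / b)) • X + b⁻¹ • Y = K'|_D` is complete on `D`; composing its integral curves with the
inclusion gives whole-line integral curves of `K'` inside `⟨⟨M_ext⟩⟩`
(`isMIntegralCurve_subtypeVal_comp_iff`).
-/

noncomputable section

set_option linter.dupNamespace false

namespace Summit.FinalStateConjecture.FinalStateConjecture.Theorems.HawkingExtensionIsKerr.SketchIdeator2

open Set Function Bundle VectorField Literature.Geometry.Lorentzian
open scoped Manifold ContDiff Topology

section LocalBracket

variable {E : Type*} [NormedAddCommGroup E] [NormedSpace ℝ E] [CompleteSpace E] {H : Type*}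
  [TopologicalSpace H] {I : ModelWithCorners ℝ E H} {M : Type*} [TopologicalSpace M]
  [ChartedSpace H M] [IsManifold I ∞ M]

/-- **`[T, a T + b Y] = 0` where `[T, Y] = 0`** (for sections differentiable at the point):
`[T, a T + b Y] = a [T, T] + b [T, Y] = b [T, Y]` (bilinearity of the Lie bracket, Mathlib
`VectorField.mlieBracket_add_right`, `mlieBracket_const_smul_right`, `mlieBracket_self`).
O'Neill 1983, Ch. 1, Lemma 18. [folklore] -/
private theorem stub_docComplete_mlieBracket_combination_eq_zero
    {T Y : Π x : M, TangentSpace I x} {x : M} (hT : MDiffAt (T% T) x) (hY : MDiffAt (T% Y) x)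
    (hTY : mlieBracket I T Y x = 0) (a b : ℝ) :
    mlieBracket I T (a • T + b • Y) x = 0 := by
  rw [mlieBracket_add_right hT.smul_const_section hY.smul_const_section,
    mlieBracket_const_smul_right hT, mlieBracket_const_smul_right hY, mlieBracket_self, hTY,
    Pi.zero_apply, smul_zero, smul_zero, add_zero]

/-- **The Lie bracket of two fields read on an open submanifold is the ambient bracket**:
for `U` open in `M` and sections `V`, `W` differentiable at `↑y`, `[V|U, W|U](y) = [V, W](↑y)`
(`V|U = ι^* V` for the inclusion `ι`, `mpullback_subtypeVal`; naturality of the bracket under the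
local diffeomorphism `ι`, Mathlib's `VectorField.mpullback_mlieBracket`; `dι = id`).  O'Neill 1983,
Ch. 1, Prop. 1.56 (brackets of `ι`-related fields). [folklore] -/
private theorem stub_docComplete_mlieBracket_restrict (U : TopologicalSpace.Opens M)
    {V W : Π x : M, TangentSpace I x} (y : U) (hV : MDiffAt (T% V) y.1)
    (hW : MDiffAt (T% W) y.1) :
    mlieBracket I (fun z : U ↦ (V z.1 : TangentSpace I z)) (fun z : U ↦ (W z.1 : TangentSpace I z))
        y = mlieBracket I V W y.1 := by
  have h2 : minSmoothness ℝ 2 ≤ (∞ : ℕ∞ω) := by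
    simp only [minSmoothness_of_isRCLikeNormedField]
    exact WithTop.coe_le_coe.mpr le_top
  haveI : IsManifold I (minSmoothness ℝ 2) U := IsManifold.of_le h2
  haveI : IsManifold I (minSmoothness ℝ 2) M := IsManifold.of_le h2
  rw [← mpullback_subtypeVal U V, ← mpullback_subtypeVal U W,
    ← mpullback_mlieBracket hV hW (contMDiff_subtype_val (n := ∞) y) h2, mpullback_apply]
  exact inverse_mfderiv_subtypeVal_apply U y _

end LocalBracket

/-- **Stub P4 (worker): `K'` is complete inside the d.o.c. once `a • T + b • K'` (`b ≠ 0`) is.**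
On the open submanifold `D = ⟨⟨M_ext⟩⟩` the fields `X = T|_D`, `Y = (a T + b K')|_D` are complete
`C^∞` fields with `[X, Y] = 0`, so `(-(a / b)) • X + b⁻¹ • Y = K'|_D` is complete (commuting
complete fields have commuting global flows composing to the flow of any linear combination,
Lee 2012, Thms. 9.12, 9.42, 9.44; `isCompleteVectorField_linearCombination_of_mlieBracket_eq_zero`),
and its integral curves, composed with the inclusion, are the required curves of `K'`. -/
theorem stub_docComplete_of_axial :
    ∀ (𝓑 : StationaryAFBlackHole.{0}) [𝓑.metric.HasLeviCivita]
      (K' : Π x : 𝓑.carrier, TangentSpace (𝓡 4) x) (a b : ℝ),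
      𝓑.IsIPlusRegular →
      𝓑.metric.toPseudoRiemannianMetric.IsKillingFieldOn K' 𝓑.doc →
      (∀ x ∈ 𝓑.doc, VectorField.mlieBracket (𝓡 4) 𝓑.killing K' x = 0) →
      b ≠ 0 →
      (∀ x ∈ 𝓑.doc, ∃ γ : ℝ → 𝓑.carrier, IsMIntegralCurve γ (a • 𝓑.killing + b • K') ∧
        γ 0 = x ∧ (∀ t, γ t ∈ 𝓑.doc) ∧ Function.Periodic γ (2 * Real.pi)) →
      ∀ x ∈ 𝓑.doc, ∃ δ : ℝ → 𝓑.carrier, IsMIntegralCurve δ K' ∧ δ 0 = x ∧ ∀ t, δ t ∈ 𝓑.doc := by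
  intro 𝓑 _ K' a b _hreg hK'on hK'c hb hper x hx
  -- the d.o.c. `D` as an open submanifold; `T` is a global Killing field
  have hF : 𝓑.metric.isOpen_chronologicalFuture 𝓑.timeOrientation :=
    LorentzianMetric.isOpen_chronologicalFuture_holds_of_boundaryless
  have hP : 𝓑.metric.isOpen_chronologicalPast 𝓑.timeOrientation :=
    LorentzianMetric.isOpen_chronologicalPast_holds_of_boundaryless
  have hdoc : IsOpen 𝓑.doc := 𝓑.isOpen_doc hF hP
  have hT : 𝓑.metric.IsKillingField 𝓑.killing := 𝓑.isStationaryKilling.isKillingField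
  -- `X = T|_D`: smooth and complete
  have hXs : ContMDiff (𝓡 4) (𝓡 4).tangent ∞ (fun y : 𝓑.docOpens hF hP ↦
      (TotalSpace.mk' E4 y (𝓑.docKilling hF hP y) : TangentBundle (𝓡 4) (𝓑.docOpens hF hP))) :=
    𝓑.contMDiff_docKilling hF hP
  have hXc : IsCompleteVectorField (𝓑.docKilling hF hP) := 𝓑.isCompleteVectorField_docKilling hF hP
  -- `Y = (a T + b K')|_D`: smooth (restriction of a section smooth on the open set `doc`)
  have hΦon : ContMDiffOn (𝓡 4) (𝓡 4).tangent ∞ (fun x ↦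
      (TotalSpace.mk' E4 x ((a • 𝓑.killing + b • K') x) : TangentBundle (𝓡 4) 𝓑.carrier))
      𝓑.doc :=
    (hT.contMDiff.contMDiffOn.const_smul_section (a := a)).add_section
      (hK'on.contMDiffOn.const_smul_section (a := b))
  have hYs : ContMDiff (𝓡 4) (𝓡 4).tangent ∞ (fun y : 𝓑.docOpens hF hP ↦
      (TotalSpace.mk' E4 y (𝓑.docAxial hF hP (a • 𝓑.killing + b • K') y) :
        TangentBundle (𝓡 4) (𝓑.docOpens hF hP))) :=
    Literature.Geometry.Manifold.contMDiff_tangentSection_of_contMDiffOn (𝓑.docOpens hF hP) hΦon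
  -- `Y` is complete: the hypothesis, co-restricted to `D`
  have hYc : IsCompleteVectorField (𝓑.docAxial hF hP (a • 𝓑.killing + b • K')) := by
    intro y
    obtain ⟨γ, hγ, h0, hmem, -⟩ := hper y.1 y.2
    exact ⟨fun t ↦ ⟨γ t, hmem t⟩, isMIntegralCurve_codRestrict (𝓑.docOpens hF hP) hγ hmem,
      Subtype.ext h0⟩
  -- `[X, Y] = 0`: naturality of the bracket under the inclusion, and `[T, a T + b K'] = 0` on `doc`
  have hXY : ∀ y : 𝓑.docOpens hF hP, mlieBracket (𝓡 4) (𝓑.docKilling hF hP)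
      (𝓑.docAxial hF hP (a • 𝓑.killing + b • K')) y = 0 := by
    intro y
    have hTd := hT.mdifferentiableAt y.1
    have hK'd := hK'on.mdifferentiableAt hdoc y.2
    have hΦd : MDifferentiableAt (𝓡 4) (𝓡 4).tangent (fun x ↦
        (TotalSpace.mk' E4 x ((a • 𝓑.killing + b • K') x) : TangentBundle (𝓡 4) 𝓑.carrier))
        y.1 :=
      (hΦon.contMDiffAt (hdoc.mem_nhds y.2)).mdifferentiableAt (by simp)
    have key := stub_docComplete_mlieBracket_restrict (I := 𝓡 4) (𝓑.docOpens hF hP)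
      (V := 𝓑.killing) (W := a • 𝓑.killing + b • K') y hTd hΦd
    rw [stub_docComplete_mlieBracket_combination_eq_zero hTd hK'd (hK'c y.1 y.2) a b] at key
    exact key
  -- `K'|_D = (-(a / b)) • X + b⁻¹ • Y` is complete
  have hcomb : IsCompleteVectorField ((-(a / b)) • 𝓑.docKilling hF hP +
      b⁻¹ • 𝓑.docAxial hF hP (a • 𝓑.killing + b • K')) :=
    isCompleteVectorField_linearCombination_of_mlieBracket_eq_zero hXs hYs hXY hXc hYc
      (-(a / b)) b⁻¹
  have heq : (-(a / b)) • 𝓑.docKilling hF hP + b⁻¹ • 𝓑.docAxial hF hP (a • 𝓑.killing + b • K') =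
      𝓑.docAxial hF hP K' := by
    funext y
    change (-(a / b)) • 𝓑.killing y.1 + b⁻¹ • (a • 𝓑.killing + b • K') y.1 = K' y.1
    simp only [Pi.add_apply, Pi.smul_apply, smul_add, smul_smul, inv_mul_cancel₀ hb, one_smul]
    rw [← add_assoc, ← add_smul, show -(a / b) + b⁻¹ * a = 0 by ring, zero_smul, zero_add]
  rw [heq] at hcomb
  -- push the integral curve through `x` down to `M`
  obtain ⟨γ, hγ, hγ0⟩ := hcomb ⟨x, hx⟩
  refine ⟨Subtype.val ∘ γ, (isMIntegralCurve_subtypeVal_comp_iff (V := K') (𝓑.docOpens hF hP)).2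
    hγ, ?_, fun t ↦ (γ t).2⟩
  rw [Function.comp_apply, hγ0]

end Summit.FinalStateConjecture.FinalStateConjecture.Theorems.HawkingExtensionIsKerr.SketchIdeator2

end
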